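import Mathlib
import HarnessLib
import Summits.HubbardSuperconductivity.HubbardSuperconductivity.Theorems.KLProgrammeKLRegimeSplitPhValueTransferShifts

/-!
# Route `KLProgramme` — ENGINE (stmt-HubbardSuperconductivity-20437 `KLRegimeEngineV17F2`), row (c) binder #8 (★ v19 `hexLadMV`), the EXCHANGE p-h value row `RQ` OFF ITS DIAGONAL
# (`Qm ≠ x + y`): the COMBINED shift `p ↦ (σ p.1, p.2 + r)`, `r = Qm − x − y` (thermal frequency step AND momentum translation) — resolvent identity, two-shift shell data,
# combined reindexing and the abstract decomposition — brick O6l-a (O6h-a × O6k-a)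
# (cell gate-hubbard-kl, seat hubbard-kl-k3c2-p2 g32, technique «thermal-bar induction n ≤ nScales β + 1 with EngineBoundsAtV4S sums»)

WHY.  After O6g `klph_exchangeRow_eq` the partner label of the rows door's `hQ` at a general pin is `p′ = (σ p.1, p.2 + Qm − x − y)`: the Matsubara index down by one AND the momentum
translated by `r := Qm − x − y` (`r = 0` is O6h's diagonal).  The two shifts compose: the translation is a bijection of the labels, the frequency step loses only the boundary
labels where the hard line vanishes (O6h-a `klph_derivWeight_eq_zero_of_boundary`).

§1 `klph_propCT_sub_general`, `klph_norm_propCT_sub_general_le` — `ĝ(p′) − ĝ(p) = (i(ω′ − ω) + (e − e′))·ĝ(p)ĝ(p′)`, `‖…‖ ≤ (|ω′ − ω| + |e′ − e|)·‖ĝ(p)‖‖ĝ(p′)‖` for ANY two labels.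
§2 two-shift shell data: `klph_shift2_sq_ge_of_shell` (`Ẇ_Λ(p) ≠ 0`, `|ω′ − ω_p| ≤ a`, `|e′ − e_p| ≤ b`, `8(a + b) ≤ Λ` ⇒ `Λ²/16 ≤ ω′² + e′²`), `klph_norm_propCT_shift2_le` (`≤ 4/Λ`),
   `klph_memberSymbol_shift2_le` (`|Φ_j(t)(ν′,k̃′) − Φ_j(t)(p)| ≤ (128/Λ²)·(a(2Λ + a) + b(2Λ + b))`).
§3 `klph_sum_shift2_reindex` — `Σ_p[p.1 ≠ bottom]·g p (σ p.1, p.2 + r) = Σ_q[q.1 ≠ top]·g (τ q.1, q.2 − r) q`; `klph_exchange_transfer_decomp_abstract` — for `hard` vanishing at the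
   boundary labels: `Σ_p[p.1 ≠ bottom]((soft p)(hard p′) + (hard p)(soft p′))·F p p′ = Σ_pΣ_s hard p·soft p·![F p″ p, F p p′] s + Σ_p hard p·((soft p″ − soft p)·F p″ p + (soft p′ − soft p)·F p p′)`
   with `p′ = (σ p.1, p.2 + r)`, `p″ = (τ p.1, p.2 − r)`; `klph_pair_corr_abstract_le` — the correction `≤ #{hard ≠ 0}·H·(2E·F∞)` for ANY two shift maps.
Pure algebra / calculus; no definitions; nothing asserts (c), K3 or superconductivity.  [cite: BenfattoGiulianiMastropietro2006, §2.5]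
-/

noncomputable section

namespace Summit.HubbardSuperconductivity.HubbardSuperconductivity.Theorems.KLRegimeSplit

set_option linter.dupNamespace false -- summit = problem name (single-conjunct summit), D-0017

open Real Set Finset Literature.MathematicalPhysics.QuantumLattice
open Literature.Probability.LatticeModels hiding torusSupNorm
open Literature.MathematicalPhysics.QuantumLattice.BandSectorCounting
open Summit.HubbardSuperconductivity.HubbardSuperconductivity.Theorems.TwoPointAssembly
open Summit.HubbardSuperconductivity.HubbardSuperconductivity.Theorems.KLProgrammeLegKernels
open Summit.HubbardSuperconductivity.HubbardSuperconductivity.Theorems.KLRegimeWick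
open Summit.HubbardSuperconductivity.HubbardSuperconductivity.Theorems.EngineV8
open Summit.HubbardSuperconductivity.HubbardSuperconductivity.Theorems.DispersionFlow
open Summit.HubbardSuperconductivity.HubbardSuperconductivity.Theorems.PerturbedFermiCurve

variable {L M : ℕ} [NeZero L] [NeZero M]

/-! ## §1 The resolvent identity for two arbitrary labels -/

section Resolvent

variable {β : ℝ} (μ : ℝ) (K : TrigPolyC4v)

omit [NeZero L] [NeZero M] in
/-- **Resolvent identity, both variables**: `ĝ(p′) − ĝ(p) = (i(ω′ − ω) + (e_p − e_{p′}))·ĝ(p)·ĝ(p′)` (`β ≠ 0`). -/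
theorem klph_propCT_sub_general (hβ : β ≠ 0) (p p' : FreqMomentum L M) :
    propCT L M β μ K p' - propCT L M β μ K p =
      (Complex.I * ((matsubaraFreq β M p'.1 : ℂ) - (matsubaraFreq β M p.1 : ℂ)) + ((nambuXiCT L μ K p.2 : ℂ) - (nambuXiCT L μ K p'.2 : ℂ))) *
        propCT L M β μ K p * propCT L M β μ K p' := by
  obtain ⟨h1, h10⟩ := propCT_eq_one_div μ K hβ p
  obtain ⟨h2, h20⟩ := propCT_eq_one_div μ K hβ p'
  set a : ℂ := -Complex.I * (matsubaraFreq β M p.1 : ℂ) + (nambuXiCT L μ K p.2 : ℂ) with ha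
  set a' : ℂ := -Complex.I * (matsubaraFreq β M p'.1 : ℂ) + (nambuXiCT L μ K p'.2 : ℂ) with ha'
  have hdiff : a - a' = Complex.I * ((matsubaraFreq β M p'.1 : ℂ) - (matsubaraFreq β M p.1 : ℂ)) + ((nambuXiCT L μ K p.2 : ℂ) - (nambuXiCT L μ K p'.2 : ℂ)) := by
    rw [ha, ha']; ring
  rw [h1, h2, one_div, one_div, inv_sub_inv h20 h10, hdiff, div_eq_mul_inv, mul_inv, mul_assoc]
  ring

omit [NeZero L] [NeZero M] in
/-- **`‖ĝ(p′) − ĝ(p)‖ ≤ (|ω′ − ω| + |e′ − e|)·‖ĝ(p)‖·‖ĝ(p′)‖.** -/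
theorem klph_norm_propCT_sub_general_le (hβ : β ≠ 0) (p p' : FreqMomentum L M) :
    ‖propCT L M β μ K p' - propCT L M β μ K p‖ ≤
      (|matsubaraFreq β M p'.1 - matsubaraFreq β M p.1| + |nambuXiCT L μ K p'.2 - nambuXiCT L μ K p.2|) * ‖propCT L M β μ K p‖ * ‖propCT L M β μ K p'‖ := by
  rw [klph_propCT_sub_general μ K hβ p p', norm_mul, norm_mul]
  refine mul_le_mul_of_nonneg_right (mul_le_mul_of_nonneg_right ?_ (norm_nonneg _)) (norm_nonneg _)
  refine (norm_add_le _ _).trans ?_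
  rw [norm_mul, Complex.norm_I, one_mul, ← Complex.ofReal_sub, ← Complex.ofReal_sub, Complex.norm_real, Complex.norm_real, Real.norm_eq_abs, Real.norm_eq_abs,
    abs_sub_comm (nambuXiCT L μ K p.2)]

end Resolvent

/-! ## §2 Shell data under the combined shift -/

section Shell

omit [NeZero L] [NeZero M] in
/-- **Two shifts stay on a comparable shell**: `Ẇ_Λ(p) ≠ 0`, `|ω′ − ω_p| ≤ a`, `|e′ − e_p| ≤ b`, `8(a + b) ≤ Λ` ⇒ `Λ²/16 ≤ ω′² + e′²`. -/
theorem klph_shift2_sq_ge_of_shell (β μ : ℝ) (K : TrigPolyC4v) {Λ : ℝ} (hΛ : 0 < Λ) {p : FreqMomentum L M}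
    (hp : deriv (fun Λ' : ℝ => hubbardCutoffWeightCT L M β μ K Λ' p) Λ ≠ 0) {ω' e' a b : ℝ} (ha : |ω' - matsubaraFreq β M p.1| ≤ a)
    (hb : |e' - nambuXiCT L μ K p.2| ≤ b) (h8 : 8 * (a + b) ≤ Λ) :
    Λ ^ 2 / 16 ≤ ω' ^ 2 + e' ^ 2 := by
  obtain ⟨hlo, -⟩ := klph_shell_of_derivWeight_ne_zero β μ K hΛ.ne' hp
  set ω := matsubaraFreq β M p.1
  set e := nambuXiCT L μ K p.2
  have ha0 : 0 ≤ a := (abs_nonneg _).trans ha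
  have hb0 : 0 ≤ b := (abs_nonneg _).trans hb
  -- `ω′² ≥ |ω|² − 2a|ω|`, `e′² ≥ |e|² − 2b|e|`
  have key : ∀ {z z' c : ℝ}, |z' - z| ≤ c → z ^ 2 - 2 * c * |z| ≤ z' ^ 2 := by
    intro z z' c hc
    have hc0 : 0 ≤ c := (abs_nonneg _).trans hc
    by_cases hz : c ≤ |z|
    · have h1 : |z| - c ≤ |z'| := by
        have := abs_sub_abs_le_abs_sub z z'
        rw [abs_sub_comm] at this
        linarith
      have h2 : (|z| - c) ^ 2 ≤ |z'| ^ 2 := pow_le_pow_left₀ (by linarith) h1 2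
      rw [sq_abs] at h2
      nlinarith [sq_abs z]
    · push Not at hz
      have : |z| ^ 2 ≤ c * |z| := by nlinarith [abs_nonneg z]
      rw [sq_abs] at this
      nlinarith [sq_nonneg z', abs_nonneg z]
  have hω := key ha
  have he := key hb
  -- `a|ω| + b|e| ≤ (a + b)·max(|ω|,|e|)`
  set m := max |ω| |e| with hm
  have hmω : |ω| ≤ m := le_max_left _ _
  have hme : |e| ≤ m := le_max_right _ _
  have hm0 : 0 ≤ m := (abs_nonneg _).trans hmω
  have hmix : 2 * a * |ω| + 2 * b * |e| ≤ 2 * (a + b) * m := by nlinarith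
  have hm2 : m ^ 2 ≤ ω ^ 2 + e ^ 2 := by
    rcases le_total |ω| |e| with h | h
    · rw [hm, max_eq_right h, sq_abs]; nlinarith [sq_nonneg ω]
    · rw [hm, max_eq_left h, sq_abs]; nlinarith [sq_nonneg e]
  have hab : a + b ≤ Λ / 8 := by linarith
  by_cases hmΛ : m ≤ Λ / 2
  · nlinarith
  · push Not at hmΛ
    nlinarith

omit [NeZero L] [NeZero M] in
/-- **The doubly shifted rung on the hard shell**: `Ẇ_Λ(p) ≠ 0`, `|ω_ν′ − ω_p| ≤ a`, `|e_K(k̃′) − e_K(k̃_p)| ≤ b`, `8(a + b) ≤ Λ` ⇒ `‖ĝ_K(ν′, k̃′)‖ ≤ 4/Λ`. -/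
theorem klph_norm_propCT_shift2_le (β μ : ℝ) (K : TrigPolyC4v) {Λ : ℝ} (hΛ : 0 < Λ) {p : FreqMomentum L M}
    (hp : deriv (fun Λ' : ℝ => hubbardCutoffWeightCT L M β μ K Λ' p) Λ ≠ 0) {ν' : MatsubaraIdx M} {k' : TorusSite 2 L} {a b : ℝ}
    (ha : |matsubaraFreq β M ν' - matsubaraFreq β M p.1| ≤ a) (hb : |nambuXiCT L μ K k' - nambuXiCT L μ K p.2| ≤ b) (h8 : 8 * (a + b) ≤ Λ) :
    ‖propCT L M β μ K (ν', k')‖ ≤ 4 / Λ := by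
  have hs := klph_shift2_sq_ge_of_shell β μ K hΛ hp ha hb h8
  rw [norm_propCT_eq]
  have hsqrt : Λ / 4 ≤ Real.sqrt (matsubaraFreq β M ν' ^ 2 + nambuXiCT L μ K k' ^ 2) := by
    rw [show Λ / 4 = Real.sqrt ((Λ / 4) ^ 2) from (Real.sqrt_sq (by positivity)).symm]
    exact Real.sqrt_le_sqrt (by linarith)
  calc (Real.sqrt (matsubaraFreq β M ν' ^ 2 + nambuXiCT L μ K k' ^ 2))⁻¹ ≤ (Λ / 4)⁻¹ := inv_anti₀ (by positivity) hsqrt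
    _ = 4 / Λ := by rw [inv_div]

omit [NeZero L] [NeZero M] in
/-- **The member symbol under the combined shift**: `|Φ_j(t)(ν′, k̃′) − Φ_j(t)(p)| ≤ (128/Λ²)·(a·(2Λ + a) + b·(2Λ + b))` on the hard shell at `Λ = Λ(t)` (`0 < Λ_j ≤ Λ`,
`|ω_ν′ − ω_p| ≤ a`, `|e_K(k̃′) − e_K(k̃_p)| ≤ b`, `0 ≤ a, b`, `8(a + b) ≤ Λ`). -/
theorem klph_memberSymbol_shift2_le (β μ : ℝ) (K : TrigPolyC4v) (n j : ℕ) {Λ : ℝ} (hΛj : 0 < klScale klE0 j) (hle : klScale klE0 j ≤ Λ)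
    {p : FreqMomentum L M} (hp : deriv (fun Λ' : ℝ => hubbardCutoffWeightCT L M β μ K Λ' p) Λ ≠ 0) {ν' : MatsubaraIdx M} {k' : TorusSite 2 L} {a b : ℝ}
    (ha0 : 0 ≤ a) (hb0 : 0 ≤ b) (ha : |matsubaraFreq β M ν' - matsubaraFreq β M p.1| ≤ a) (hb : |nambuXiCT L μ K k' - nambuXiCT L μ K p.2| ≤ b) (h8 : 8 * (a + b) ≤ Λ) :
    |(softSymbolCompl L M β μ K (n + 1) j (ν', k') +
          (hubbardCutoffWeightCT L M β μ K (klScale klE0 (n + 1)) (ν', k') - hubbardCutoffWeightCT L M β μ K Λ (ν', k'))) -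
        (softSymbolCompl L M β μ K (n + 1) j p + (hubbardCutoffWeightCT L M β μ K (klScale klE0 (n + 1)) p - hubbardCutoffWeightCT L M β μ K Λ p))| ≤
      128 / Λ ^ 2 * (a * (2 * Λ + a) + b * (2 * Λ + b)) := by
  have hΛ : 0 < Λ := hΛj.trans_le hle
  rw [klfw_memberSymbol_eq β μ K n j Λ (ν', k'), klfw_memberSymbol_eq β μ K n j Λ p]
  obtain ⟨hlo, hhi⟩ := klph_shell_of_derivWeight_ne_zero β μ K hΛ.ne' hp
  have hs' := klph_shift2_sq_ge_of_shell β μ K hΛ hp ha hb h8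
  have h := klph_klPhi_local_lipschitz hΛj hle hlo hs'
  refine h.trans (mul_le_mul_of_nonneg_left ?_ (by positivity))
  set ω := matsubaraFreq β M p.1
  set ω' := matsubaraFreq β M ν'
  set e := nambuXiCT L μ K p.2
  set e' := nambuXiCT L μ K k'
  have hωΛ : |ω| ≤ Λ := by
    rw [← Real.sqrt_sq hΛ.le, ← Real.sqrt_sq_eq_abs]
    exact Real.sqrt_le_sqrt (by nlinarith [sq_nonneg e])
  have heΛ : |e| ≤ Λ := by
    rw [← Real.sqrt_sq hΛ.le, ← Real.sqrt_sq_eq_abs]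
    exact Real.sqrt_le_sqrt (by nlinarith [sq_nonneg ω])
  have hsumω : |ω' + ω| ≤ 2 * Λ + a := by
    calc |ω' + ω| = |(ω' - ω) + 2 * ω| := by ring_nf
      _ ≤ |ω' - ω| + |2 * ω| := abs_add_le _ _
      _ ≤ a + 2 * Λ := by rw [abs_mul, abs_two]; linarith
      _ = 2 * Λ + a := by ring
  have hsume : |e' + e| ≤ 2 * Λ + b := by
    calc |e' + e| = |(e' - e) + 2 * e| := by ring_nf
      _ ≤ |e' - e| + |2 * e| := abs_add_le _ _
      _ ≤ b + 2 * Λ := by rw [abs_mul, abs_two]; linarith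
      _ = 2 * Λ + b := by ring
  have h1 : |ω' ^ 2 - ω ^ 2| ≤ a * (2 * Λ + a) := by
    rw [show ω' ^ 2 - ω ^ 2 = (ω' - ω) * (ω' + ω) by ring, abs_mul]
    exact mul_le_mul ha hsumω (abs_nonneg _) ha0
  have h2 : |e' ^ 2 - e ^ 2| ≤ b * (2 * Λ + b) := by
    rw [show e' ^ 2 - e ^ 2 = (e' - e) * (e' + e) by ring, abs_mul]
    exact mul_le_mul hb hsume (abs_nonneg _) hb0
  calc |ω' ^ 2 + e' ^ 2 - (ω ^ 2 + e ^ 2)| = |(ω' ^ 2 - ω ^ 2) + (e' ^ 2 - e ^ 2)| := by ring_nf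
    _ ≤ |ω' ^ 2 - ω ^ 2| + |e' ^ 2 - e ^ 2| := abs_add_le _ _
    _ ≤ a * (2 * Λ + a) + b * (2 * Λ + b) := add_le_add h1 h2

end Shell

/-! ## §3 The combined reindexing and the abstract decomposition -/

section Decomp

variable {σ τ : MatsubaraIdx M → MatsubaraIdx M}
  (hσ : ∀ ν : MatsubaraIdx M, (ν : ℕ) ≠ 0 → matsubaraInt M (σ ν) = matsubaraInt M ν - 1)
  (hτ : ∀ ν : MatsubaraIdx M, (ν : ℕ) ≠ 2 * M - 1 → matsubaraInt M (τ ν) = matsubaraInt M ν + 1)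
include hσ hτ

omit [NeZero M] in
/-- **Combined reindexing**: `Σ_p [p.1 ≠ bottom]·g p (σ p.1, p.2 + r) = Σ_q [q.1 ≠ top]·g (τ q.1, q.2 − r) q`. -/
theorem klph_sum_shift2_reindex [NeZero M] (r : TorusSite 2 L) (g : FreqMomentum L M → FreqMomentum L M → ℂ) :
    (∑ p : FreqMomentum L M, if (p.1 : ℕ) = 0 then 0 else g p (σ p.1, p.2 + r)) =
      ∑ q : FreqMomentum L M, if (q.1 : ℕ) = 2 * M - 1 then 0 else g (τ q.1, q.2 - r) q := by
  -- first the frequency step (O6h-a), at the translated momentum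
  have h1 := klph_sum_shift_reindex (L := L) hσ hτ (fun p q => g p (q.1, q.2 + r))
  rw [h1]
  -- then the momentum translation (a bijection)
  have h2 := klph_sum_mshift_reindex (L := L) (M := M) r
    (fun _ q => if (q.1 : ℕ) = 2 * M - 1 then 0 else g (τ q.1, q.2 - r) q)
  simpa only [add_sub_cancel_right] using h2

omit [NeZero M] in
/-- **ABSTRACT DECOMPOSITION OF THE EXCHANGE ROW AT A GENERAL PIN** (`p′ = (σ p.1, p.2 + r)`, `p″ = (τ p.1, p.2 − r)`): for `hard` vanishing at the two boundary labels,
`Σ_p [p.1 ≠ bottom]((soft p)(hard p′) + (hard p)(soft p′))·F p p′ = Σ_pΣ_s (hard p·soft p)·![F p″ p, F p p′] s + Σ_p hard p·((soft p″ − soft p)·F p″ p + (soft p′ − soft p)·F p p′)`. -/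
theorem klph_exchange_transfer_decomp_abstract [NeZero M] (r : TorusSite 2 L) (hard soft : FreqMomentum L M → ℂ) (F : FreqMomentum L M → FreqMomentum L M → ℂ)
    (hbot : ∀ p : FreqMomentum L M, (p.1 : ℕ) = 0 → hard p = 0) (htop : ∀ p : FreqMomentum L M, (p.1 : ℕ) = 2 * M - 1 → hard p = 0) :
    (∑ p : FreqMomentum L M, if (p.1 : ℕ) = 0 then 0 else (soft p * hard (σ p.1, p.2 + r) + hard p * soft (σ p.1, p.2 + r)) * F p (σ p.1, p.2 + r)) =
      (∑ p : FreqMomentum L M, ∑ s : Fin 2, (hard p * soft p) * (![F (τ p.1, p.2 - r) p, F p (σ p.1, p.2 + r)] : Fin 2 → ℂ) s) +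
        ∑ p : FreqMomentum L M, hard p * ((soft (τ p.1, p.2 - r) - soft p) * F (τ p.1, p.2 - r) p + (soft (σ p.1, p.2 + r) - soft p) * F p (σ p.1, p.2 + r)) := by
  -- split the two orderings
  have hsplit : (∑ p : FreqMomentum L M, if (p.1 : ℕ) = 0 then 0 else (soft p * hard (σ p.1, p.2 + r) + hard p * soft (σ p.1, p.2 + r)) * F p (σ p.1, p.2 + r)) =
      (∑ p : FreqMomentum L M, if (p.1 : ℕ) = 0 then 0 else soft p * hard (σ p.1, p.2 + r) * F p (σ p.1, p.2 + r)) +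
        ∑ p : FreqMomentum L M, if (p.1 : ℕ) = 0 then 0 else hard p * soft (σ p.1, p.2 + r) * F p (σ p.1, p.2 + r) := by
    rw [← sum_add_distrib]
    refine sum_congr rfl fun p _ => ?_
    split_ifs <;> ring
  have hre := klph_sum_shift2_reindex (L := L) hσ hτ r (fun p q => soft p * hard q * F p q)
  have hA : (∑ p : FreqMomentum L M, if (p.1 : ℕ) = 0 then 0 else soft p * hard (σ p.1, p.2 + r) * F p (σ p.1, p.2 + r)) =
      ∑ q : FreqMomentum L M, hard q * (soft (τ q.1, q.2 - r) * F (τ q.1, q.2 - r) q) := by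
    rw [hre]
    refine sum_congr rfl fun q _ => ?_
    by_cases hq : (q.1 : ℕ) = 2 * M - 1
    · rw [if_pos hq, htop q hq, zero_mul]
    · rw [if_neg hq]; ring
  have hB : (∑ p : FreqMomentum L M, if (p.1 : ℕ) = 0 then 0 else hard p * soft (σ p.1, p.2 + r) * F p (σ p.1, p.2 + r)) =
      ∑ p : FreqMomentum L M, hard p * (soft (σ p.1, p.2 + r) * F p (σ p.1, p.2 + r)) := by
    refine sum_congr rfl fun p _ => ?_
    by_cases hp : (p.1 : ℕ) = 0
    · rw [if_pos hp, hbot p hp, zero_mul]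
    · rw [if_neg hp]; ring
  rw [hsplit, hA, hB, ← sum_add_distrib, ← sum_add_distrib]
  refine sum_congr rfl fun p _ => ?_
  simp only [Fin.sum_univ_two, Matrix.cons_val_zero, Matrix.cons_val_one]
  ring

omit [NeZero M] hσ hτ in
/-- **The one-more-rung correction, sign-blind, for ANY two shift maps** `dn up : FreqMomentum → FreqMomentum`: with `‖hard p‖ ≤ H`, `‖soft (dn p) − soft p‖, ‖soft (up p) − soft p‖ ≤ E`,
`‖F (dn p) p‖, ‖F p (up p)‖ ≤ F∞` wherever `hard p ≠ 0`: `‖Σ_p hard p·((soft (dn p) − soft p)·F (dn p) p + (soft (up p) − soft p)·F p (up p))‖ ≤ #{hard ≠ 0}·(H·(2E·F∞))`. -/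
theorem klph_pair_corr_abstract_le [NeZero M] (up dn : FreqMomentum L M → FreqMomentum L M) (hard soft : FreqMomentum L M → ℂ)
    (F : FreqMomentum L M → FreqMomentum L M → ℂ) {H E Finf : ℝ} (hH0 : 0 ≤ H) (hE0 : 0 ≤ E)
    (hH : ∀ p, hard p ≠ 0 → ‖hard p‖ ≤ H)
    (hE : ∀ p, hard p ≠ 0 → ‖soft (dn p) - soft p‖ ≤ E ∧ ‖soft (up p) - soft p‖ ≤ E)
    (hF : ∀ p, hard p ≠ 0 → ‖F (dn p) p‖ ≤ Finf ∧ ‖F p (up p)‖ ≤ Finf) :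
    ‖∑ p : FreqMomentum L M, hard p * ((soft (dn p) - soft p) * F (dn p) p + (soft (up p) - soft p) * F p (up p))‖ ≤
      ((univ.filter fun p : FreqMomentum L M => hard p ≠ 0).card : ℝ) * (H * (2 * E * Finf)) := by
  classical
  have hpt : ∀ p : FreqMomentum L M,
      ‖hard p * ((soft (dn p) - soft p) * F (dn p) p + (soft (up p) - soft p) * F p (up p))‖ ≤ if hard p ≠ 0 then H * (2 * E * Finf) else 0 := by
    intro p
    by_cases hp : hard p = 0
    · simp [hp]
    · rw [if_pos hp, norm_mul]
      obtain ⟨hE1, hE2⟩ := hE p hp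
      obtain ⟨hF1, hF2⟩ := hF p hp
      have h2 : ‖(soft (dn p) - soft p) * F (dn p) p + (soft (up p) - soft p) * F p (up p)‖ ≤ 2 * E * Finf := by
        refine (norm_add_le _ _).trans ?_
        rw [norm_mul, norm_mul]
        have := mul_le_mul hE1 hF1 (norm_nonneg _) hE0
        have := mul_le_mul hE2 hF2 (norm_nonneg _) hE0
        linarith
      exact mul_le_mul (hH p hp) h2 (norm_nonneg _) hH0
  calc ‖∑ p : FreqMomentum L M, hard p * ((soft (dn p) - soft p) * F (dn p) p + (soft (up p) - soft p) * F p (up p))‖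
      ≤ ∑ p : FreqMomentum L M, ‖hard p * ((soft (dn p) - soft p) * F (dn p) p + (soft (up p) - soft p) * F p (up p))‖ := norm_sum_le _ _
    _ ≤ ∑ p : FreqMomentum L M, (if hard p ≠ 0 then H * (2 * E * Finf) else 0) := sum_le_sum fun p _ => hpt p
    _ = ((univ.filter fun p : FreqMomentum L M => hard p ≠ 0).card : ℝ) * (H * (2 * E * Finf)) := by
        rw [← sum_filter, sum_const, nsmul_eq_mul]

end Decomp

end Summit.HubbardSuperconductivity.HubbardSuperconductivity.Theorems.KLRegimeSplit

end
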